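import Summits.BirchSwinnertonDyer.Rank1Residual.X11b.AnticyclotomicLogLinks
import HarnessLib

/-!
# X11b, route p2 (the sibling sub-cell's BDP + Kolyvagin route) — its one-sided input STEP L with
# EVERY symbol a tree object: (IMC≥)∘(BDP) at the trivial character and (CTL) on the constructed `X_ac`

HONEST FRAMING (cell `b2b-bsdres`, run/shared/lean/b2b/bsd-rank1-residual/, verbatim in every
file): the goal of the cell is to DELETE the COMBINATION-SHAPED residual classes of the
Birch–Swinnerton-Dyer formula for ALL analytic-rank `≤ 1` elliptic curves over `ℚ` — "full BSD
formula for every rank `≤ 1` curve in class `C`" assembled STRICTLY from published theorems — so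
that the rank-`≤ 1` remainder becomes exactly the CONSTRUCTION-SHAPED classes, which are TYPED
(missing-input `Prop`s), NOT attempted. This is not "finishing BSD". Sub-cell
`b2b-bsdres-multr1-p1` (X11b, route R1), serving the sibling route p2 (`BDPRouteLinks.lean`,
multr1-p2); RESEARCH ROUTES; no claim beyond the stated class; X11b stays CONSTRUCTION-SHAPED;
nothing here changes a label; no named fact (one `Prop`-valued predicate with parameters naming an
OPEN shape, and theorems; every result using it is CONDITIONAL; no `sorry`).

## Content

`BDPRouteLinks.lean` (multr1-p2) isolates the open input of the BDP + Kolyvagin route as the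
ONE-SIDED divisibility at the trivial character, `LambdaAdicShadow.IMCLowerAtTrivialChar :
ord_p L_p(f)(𝟙) ≤ ord_p f_ac(0)` ("`Ch_Λ(X_ac(E[p^∞])) ⊆ (L_p(f))Λ_{R₀}`", at `p ∥ N` only from the
erratum's (2.4) "By [FW21, Thm. 4.41]"), and proves STEP L = `IndexLowerBoundAt` from it and the
published links (BDP), (CTL), (TAM) on the shadow (`indexLowerBoundAt_of_shadowLinks`, JSW17 §7.4.1
shape). With gen 8's tree objects (`AnticyclotomicSelmerDual`: `X_ac`; `AnticyclotomicEmbedding`: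
`padicLogOrd`; `AnticyclotomicTamagawa`: `∏_{w∣N⁺} c_w`) the same elimination of the unconstructed
`L_p(f)(𝟙)` as in `AnticyclotomicLogLinks` gives:

* **`IMCLowerWaldspurgerOnTreeAt p κ 𝔭 γ ι P`** — (IMC≥)∘(BDP) at `𝟙`, OPEN ∘ PUB, every symbol a
  tree object: `2·(ord_p log_{ω_E} P − 1) ≤ ord_p f(0)` for a generator `f` of `Ch_Λ` of the
  constructed `X_ac(E[p^∞])` (torsion, `f(0) ≠ 0`). `[claim: Castella2018Erratum, status: under-review]`.
* `imcLowerWaldspurgerOnTreeAt_of_imcWaldspurgerOnTreeAt` — route R1's open link (equality) implies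
  route p2's (inequality).
* **`indexLowerBoundAt_of_onTreeLowerLinks`** — (IMC≥∘BDP)ᵗ [OPEN] + (CTL)ᵗ [PUB shape,
  `ControlOnTreeAt`] + the theorem (TAM-q) on an erratum field + `Ш(E/K)` finite + the Tamagawa
  transport value `ord_p ∏_w c_w(E/K) = 2·ord_p ∏_ℓ c_ℓ(E)` ⟹ `IndexLowerBoundAt W p K P` (multr1-p2's
  STEP L at the datum) — via the shadow OUTPUT and `indexLowerBoundAt_of_shadowLinks`.
* `indexLowerBoundAt_of_onTreeLinks` — in particular from route R1's two tree-object links.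

CONDITIONAL on the open link; deletes nothing; no label change.

References: [JetchevSkinnerWan2017] §7.4.1 (eq:shalowerK-1) (arXiv:1512.06894 p. 30); [Castella2018]
(1.1), Thm. 2.3, Thm. 3.2, §5; [Castella2018Erratum] (2.4), Thm. 1.1.
-/

noncomputable section

open scoped Classical

open WeierstrassCurve NumberField IsDedekindDomain Literature.NumberTheory.EllipticCurves
  Literature.NumberTheory.EllipticCurves.Rank1Residual
  Summit.BirchSwinnertonDyer.Rank1Residual.X11b.AcSelmer

namespace Summit.BirchSwinnertonDyer.Rank1Residual.X11b

section Lower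

variable {W : WeierstrassCurve ℚ} [W.IsElliptic] [W.IsGloballyMinimal] {K : Type} [Field K]
  [NumberField K]
variable (p : ℕ) [Fact p.Prime] (κ : ZpExtension K p) (𝔭 : HeightOneSpectrum (𝓞 K))
  (γ : Field.absoluteGaloisGroup K) [Fact (κ.IsTopGenerator γ)] (ι : K →+* ℚ_[p])

/-- **(IMC≥) ∘ (BDP) at the trivial character, EVERY SYMBOL A TREE OBJECT — OPEN ∘ PUB** (route p2's
input): the one-sided divisibility "`Ch_Λ(X_ac(E[p^∞])) ⊆ (L_p(f))Λ_{R₀}`" at `𝟙`,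
`ord_p L_p(f)(𝟙) ≤ ord_p f_ac(0)` [at `p ∥ N`: erratum (2.4) "By [FW21, Thm. 4.41]", UNREFEREED],
composed with Cas18 Thm. 3.2 at `p ∣ N` [`L_p(f)(𝟙) = (1 − a_p p⁻¹)²(log_{ω_E} P_K)²` up to a unit,
PUB]: `2·(ord_p log_ω P − 1) ≤ ord_p f(0)` for a generator `f` (with `f(0) ≠ 0`) of the characteristic
ideal of the constructed, `Λ`-torsion `X_ac = AcSelmer.XAc (E_K) p κ 𝔭 ∅ γ`, `ord_p log_ω P =
padicLogOrd W p ι P`. A predicate; NEVER a theorem. [claim: Castella2018Erratum, status: under-review]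
[cite: Castella2018, Thm. 3.2 (arXiv:1704.06608 p. 9) (shape only; nothing asserted)] -/
def IMCLowerWaldspurgerOnTreeAt (P : (W.baseChange K).toAffine.Point) : Prop :=
  ∃ n : ℕ, XAc.HasCharValuationAt (W.baseChange K) p κ 𝔭 ∅ γ n ∧
    2 * (padicLogOrd W p ι P - 1) ≤ (n : ℤ)

variable {p κ 𝔭 γ ι}

/-- Route R1's tree-object open link (equality) implies route p2's (inequality). [folklore] -/
theorem imcLowerWaldspurgerOnTreeAt_of_imcWaldspurgerOnTreeAt {P : (W.baseChange K).toAffine.Point}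
    (h : IMCWaldspurgerOnTreeAt p κ 𝔭 γ ι P) : IMCLowerWaldspurgerOnTreeAt p κ 𝔭 γ ι P := by
  obtain ⟨n, hn, hne⟩ := h
  exact ⟨n, hn, le_of_eq hne.symm⟩

/-- **STEP L from the tree-object links** (JSW17 §7.4.1 shape, Castella (1.1)): on an erratum field
(`p ≥ 5`, `q` multiplicative with `E[p]` ramified — for the theorem (TAM-q)), with `Ш(E/K)` finite and
the Tamagawa transport value `ord_p ∏_w c_w(E/K) = 2·ord_p ∏_ℓ c_ℓ(E)`, the OPEN (IMC≥∘BDP)ᵗ and the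
PUB-shaped (CTL)ᵗ at one `(κ, γ, 𝔭, ι)` give `IndexLowerBoundAt W p K P`. Proof: the shadow
`⟨n, 2(L−1), L, ord_p ∏_{w∣N⁺} c_w⟩` built from the tree numbers satisfies (IMC≥), (BDP), (CTL),
(TAM-q), then `indexLowerBoundAt_of_shadowLinks`. CONDITIONAL on the open link.
[cite: JetchevSkinnerWan2017, §7.4.1 (eq:shalowerK-1) (arXiv:1512.06894 p. 30)]
[cite: Castella2018, (1.1) (p. 2), Thm. 2.3, Thm. 3.2, §5 (5.2)–(5.3)] -/
theorem indexLowerBoundAt_of_onTreeLowerLinks [Finite (W.baseChange K).sha] (hp : 5 ≤ p) {q : ℕ}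
    [Fact q.Prime] (hmq : Mult W q) (hvq : ¬ p ∣ padicValInt q W.minimalDiscriminantInt)
    (hK : IsErratumField W K q) {P : (W.baseChange K).toAffine.Point}
    (hIW : IMCLowerWaldspurgerOnTreeAt p κ 𝔭 γ ι P) (hCTL : ControlOnTreeAt p κ 𝔭 γ ι P)
    (htamK : padicValNat p (W.baseChange K).tamagawaProduct = 2 * padicValNat p W.tamagawaProduct) :
    IndexLowerBoundAt W p K P := by
  obtain ⟨n, hn, hle⟩ := hIW
  obtain ⟨n', hn', hne'⟩ := hCTL
  obtain rfl : n = n' := hn.unique hn'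
  refine indexLowerBoundAt_of_shadowLinks p
    ⟨n, 2 * (padicLogOrd W p ι P - 1), padicLogOrd W p ι P, padicValNat p (tamagawaProductSplit W K)⟩
    hle rfl hne' ?_ htamK
  exact LambdaAdicShadow.tamagawaAtRamifiedAt_of_eq_tamagawaProductSplit p _ (hp := hp) hmq hvq hK
    rfl

/-- **STEP L from route R1's tree-object links** (the equality form), same side conditions.
[cite: JetchevSkinnerWan2017, §7.4.1 (eq:shalowerK-1) (arXiv:1512.06894 p. 30)] [cite: Castella2018, (5.3) and (1.1)] -/
theorem indexLowerBoundAt_of_onTreeLinks [Finite (W.baseChange K).sha] (hp : 5 ≤ p) {q : ℕ}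
    [Fact q.Prime] (hmq : Mult W q) (hvq : ¬ p ∣ padicValInt q W.minimalDiscriminantInt)
    (hK : IsErratumField W K q) {P : (W.baseChange K).toAffine.Point}
    (hIW : IMCWaldspurgerOnTreeAt p κ 𝔭 γ ι P) (hCTL : ControlOnTreeAt p κ 𝔭 γ ι P)
    (htamK : padicValNat p (W.baseChange K).tamagawaProduct = 2 * padicValNat p W.tamagawaProduct) :
    IndexLowerBoundAt W p K P :=
  indexLowerBoundAt_of_onTreeLowerLinks hp hmq hvq hK
    (imcLowerWaldspurgerOnTreeAt_of_imcWaldspurgerOnTreeAt hIW) hCTL htamK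

/-- Without the Tamagawa transport value: the tree-object lower links give the one-sided form of
Castella's (5.2) over `K` — the Jetchev–Skinner–Wan LOWER BOUND on `Ш`:
`2·ord_p[E(K):ℤP] ≤ ord_p #Ш(E/K)[p^∞] + ord_p ∏_{w∣N⁺} c_w(E/K)` (`(L_p(f)) ⊇ Ch` bounds `f_ac(0)`
from below), every symbol a tree object. CONDITIONAL on the open link.
[cite: JetchevSkinnerWan2017, §7.4.1 (eq:shalowerK-1) (arXiv:1512.06894 p. 30)]
[cite: Castella2018, (1.1) (p. 2) and §5 (5.2) (arXiv:1704.06608 pp. 2, 12)] -/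
theorem two_mul_index_le_of_onTreeLowerLinks {P : (W.baseChange K).toAffine.Point}
    (hIW : IMCLowerWaldspurgerOnTreeAt p κ 𝔭 γ ι P) (hCTL : ControlOnTreeAt p κ 𝔭 γ ι P) :
    2 * (padicValNat p (AddSubgroup.zmultiples P).index : ℤ) ≤
      (padicValNat p (Nat.card (AddCommGroup.primaryComponent (W.baseChange K).sha p)) : ℤ) +
        padicValNat p (tamagawaProductSplit W K) := by
  obtain ⟨n, hn, hle⟩ := hIW
  obtain ⟨n', hn', hne'⟩ := hCTL
  obtain rfl : n = n' := hn.unique hn'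
  omega

end Lower

end Summit.BirchSwinnertonDyer.Rank1Residual.X11b

end
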